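import Summits.ResolutionOfSingularities.ResolutionOfSingularities.Theses.WeightedInvariant
import Literature.AlgebraicGeometry.Resolution.CobordantChartCoefficients
import Literature.AlgebraicGeometry.Resolution.PowerSeriesCleaning
import Summits.ResolutionOfSingularities.ResolutionOfSingularities.Theorems.WeightedInvariantWeightedConstructionCleanSplit
import Summits.ResolutionOfSingularities.ResolutionOfSingularities.Theorems.WeightedInvariantWeightedConstructionCleanOrderStable
import Summits.ResolutionOfSingularities.ResolutionOfSingularities.Theorems.WeightedInvariantWeightedConstructionFuelLemma

/-!
# Line `weighted-oblique-fuel` for crux `WeightedConstruction` (stmt-ResolutionOfSingularities-0571)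

Lead's skeleton (`work/WeightedConstruction.lean` = `Cruxes/WeightedConstruction/Lines/weighted-oblique-fuel.lean`).
The planner's checked skeleton (evidence `20260816T052258Z-line-weighted-oblique-fuel.lean`,
sha 568bc8fe83d9) is not mounted in the lead's jail; this file RESTATES the line with the four
stub signatures VERBATIM from the ledger registration (`stub_cleanSplit`, `stub_cleanOrderStable`,
`stub_fuelControlledMove`, `stub_datumOfLocalFuelCriterion`) over the tree definitions
`Literature.AlgebraicGeometry.Resolution.qClean` / `succCoeff` (file `PowerSeriesCleaning.lean`,
proposed by the lead) and `CobordantChart.chart`, plus one infrastructural stub `stub_fuelLemma`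
(the card's GENERAL FUEL LEMMA, which the planner proved inline: without fuel at the exceptional
point the successor coefficient series is already clean), and the sorry-free composition
`WeightedConstruction_of`.

## The line (idea card `Ideas/weighted-oblique-fuel.md`, Hauser–Perlega purely inseparable setting)

Local objects: a perfect field `k` of characteristic `p`, `q = pᵉ` (`0 < e`), a CLEAN coefficient
series `G ∈ k[[x₁, …, xₘ]]` (no monomial with all exponents divisible by `q`) of order `≥ q` — the
equation `f = z^q + G(x)` of multiplicity `q`. A MOVE is a formal coordinate change `θ` (zero
constant terms, invertible linear part) followed by the weighted cobordant blow-up with weights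
`w` on the `x`-variables (`wᵢ = 0` ⇔ `xᵢ` is a parameter along the centre; `z` gets weight `d/q`,
`d` = `w`-order of `G̃ := qClean q (G ∘ θ)`, which is why `q ∣ d` is demanded). At an exceptional
point `c ≠ 0` (`cᵢ = 0` where `wᵢ = 0`) the transform is `G̃(s^w(c+y)) = s^d · T'`, `s ∤ T'`, the
strict transform of `f` is `z'^q + T'`, the constant term of `T'` is absorbed into `z'`
(`succCoeff T' = T' − T'(0)`) and the `q`-th powers are cleaned away (`stub_cleanSplit`):
`f' = z''^q + qClean q (succCoeff T')`. FUEL at `c`: a monomial `α ∈ supp G̃` with `q ∣ αₗ`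
whenever `cₗ = 0` and `q ∣ w·α` — by the chart coefficient formula the only source of new
`q`-th-power monomials (`stub_fuelLemma`).

* `stub_cleanSplit` [M] — over a perfect field every series splits as `H = qClean q H + R^q`.
* `stub_cleanOrderStable` [L] — for CLEAN `G` the cleaned order is invariant under formal
  coordinate changes: `ord (qClean q (G∘θ)) = ord G` (an initial form all of whose monomials become
  `q`-th powers after an invertible linear change was a polynomial in `xᵢ^q` before, by Frobenius).
* `stub_fuelLemma` [M] — no fuel at `c` ⇒ every `q`-th-power coefficient of `T'` vanishes
  (from `CobordantChart.coeff_subst_chart`; characteristic-free).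
* `stub_fuelControlledMove` [XL] — THE LOCAL CONJECTURE (weighted Moh stability with coordinate
  choice): for every clean `G ≠ 0` of order `≥ q` there is a move `(θ, w)` with `0 < d`, `q ∣ d` at
  every exceptional point, such that wherever `T'` has no linear terms the raw successor
  `succCoeff T'` has order `< ord G`, and at fuelled points so does the cleaned successor.
* `stub_datumOfLocalFuelCriterion` [XL, hardest, transfer, the lead's] — the LOCAL FUEL CRITERION
  (conjunction of the above, stated for perfect `k`) ⇒ `Nonempty (WeightedResolutionDatum p)`.

`WeightedConstruction_of` composes them: the criterion's cleaned-order clause is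
`stub_cleanOrderStable`, its splitting clause is `stub_cleanSplit` at `succCoeff T'` (constant term
`0`), its cleanness clause is `isClean_qClean`, and its drop clause is `stub_fuelControlledMove`'s
fuelled clause at fuelled points and its raw clause transported along
`qClean q (succCoeff T') = succCoeff T'` (`stub_fuelLemma` + `qClean_eq_self`) at fuel-free points.
-/

noncomputable section

open Literature.AlgebraicGeometry.Resolution
open Summit.ResolutionOfSingularities.ResolutionOfSingularities.Theses.WeightedInvariant

set_option linter.dupNamespace false

namespace Summit.ResolutionOfSingularities.ResolutionOfSingularities.Cruxes.WeightedConstruction.WeightedObliqueFuel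

/-- `stub_cleanSplit` [M] — LANDED (p86233, `Theorems.stub_cleanSplit`): `pᵉ`-TH-ROOT SPLITTING over a perfect field — every power series is its
cleaning plus a `pᵉ`-th power, and the root has no constant term when the series has none
(`R := Σ_{q ∣ α} a_α^{1/q} x^{α/q}`, Frobenius is additive). Registered signature (verbatim). -/
theorem stub_cleanSplit : ∀ (p : ℕ), p.Prime → ∀ (k : Type) [Field k] [CharP k p] [PerfectField k] (e m : ℕ) (H : MvPowerSeries (Fin m) k), ∃ R : MvPowerSeries (Fin m) k, H = qClean (p ^ e) H + R ^ (p ^ e) ∧ (MvPowerSeries.constantCoeff H = 0 → MvPowerSeries.constantCoeff R = 0) :=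
  Theorems.stub_cleanSplit

/-- `stub_cleanOrderStable` [L] — LANDED (p85858, `Theorems.stub_cleanOrderStable`): for a CLEAN series the cleaned order is invariant under formal
coordinate changes. Registered signature (verbatim). -/
theorem stub_cleanOrderStable : ∀ (p : ℕ), p.Prime → ∀ (k : Type) [Field k] [CharP k p] (e m : ℕ) (G : MvPowerSeries (Fin m) k), (∀ α : Fin m →₀ ℕ, (∀ l, p ^ e ∣ α l) → MvPowerSeries.coeff α G = 0) → ∀ (θ : Fin m → MvPowerSeries (Fin m) k), (∀ i, MvPowerSeries.constantCoeff (θ i) = 0) → IsUnit (Matrix.det (Matrix.of fun i j => MvPowerSeries.coeff (Finsupp.single j 1) (θ i))) → (qClean (p ^ e) (MvPowerSeries.subst θ G)).order = G.order :=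
  Theorems.stub_cleanOrderStable

/-- `stub_fuelLemma` [M] — LANDED (p85518, `Theorems.stub_fuelLemma`): GENERAL FUEL LEMMA — at an exceptional point `c` without fuel for `F`
(no `α ∈ supp F` with `q ∣ αₗ` for all `l` with `cₗ = 0` and `q ∣ w·α`), the `s`-saturated
transform `T'` (`F(s^w(c+y)) = s^d T'`, `q ∣ d`) has no `q`-th-power monomial at all: by
`CobordantChart.coeff_subst_chart` a coefficient `s^r y^β` of `T'` with `q ∣ r`, `q ∣ β` is a sum over
exponents `α` of weight `r + d` with `αₗ = βₗ` wherever `cₗ = 0`, i.e. over fuel. Characteristic-free. -/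
theorem stub_fuelLemma : ∀ (q : ℕ) (k : Type) [Field k] (m : ℕ) (F : MvPowerSeries (Fin m) k) (w : Fin m → ℕ) (c : Fin m → k), (∀ i, w i = 0 → c i = 0) → ∀ (d : ℕ) (T' : MvPowerSeries (Fin (m + 1)) k), q ∣ d → MvPowerSeries.subst (CobordantChart.chart w c) F = MvPowerSeries.X 0 ^ d * T' → (¬ ∃ α : Fin m →₀ ℕ, MvPowerSeries.coeff α F ≠ 0 ∧ (∀ l, c l = 0 → q ∣ α l) ∧ q ∣ Finsupp.weight w α) → ∀ β : Fin (m + 1) →₀ ℕ, (∀ l, q ∣ β l) → MvPowerSeries.coeff β T' = 0 :=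
  Theorems.stub_fuelLemma

/-- `stub_fuelControlledMove` [XL]: THE LOCAL CONJECTURE of the line (weighted Moh stability with
coordinate choice, Hauser–Perlega purely inseparable setting). Registered signature (verbatim). -/
theorem stub_fuelControlledMove : ∀ (p : ℕ), p.Prime → ∀ (k : Type) [Field k] [CharP k p] (e : ℕ), 0 < e → ∀ (m : ℕ) (G : MvPowerSeries (Fin m) k), G ≠ 0 → (∀ α : Fin m →₀ ℕ, (∀ l, p ^ e ∣ α l) → MvPowerSeries.coeff α G = 0) → ((p ^ e : ℕ) : ℕ∞) ≤ G.order → ∃ (θ : Fin m → MvPowerSeries (Fin m) k) (w : Fin m → ℕ), (∀ i, MvPowerSeries.constantCoeff (θ i) = 0) ∧ IsUnit (Matrix.det (Matrix.of fun i j => MvPowerSeries.coeff (Finsupp.single j 1) (θ i))) ∧ (∃ i, 0 < w i) ∧ ∀ c : Fin m → k, (∀ i, w i = 0 → c i = 0) → c ≠ 0 → ∀ (d : ℕ) (T' : MvPowerSeries (Fin (m + 1)) k), MvPowerSeries.subst (CobordantChart.chart w c) (qClean (p ^ e) (MvPowerSeries.subst θ G)) = MvPowerSeries.X 0 ^ d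 * T' → ¬ (MvPowerSeries.X (0 : Fin (m + 1)) ∣ T') → 0 < d ∧ p ^ e ∣ d ∧ ((∀ j, MvPowerSeries.coeff (Finsupp.single j 1) T' = 0) → (succCoeff T' = 0 ∨ (succCoeff T').order < G.order) ∧ ((∃ α : Fin m →₀ ℕ, MvPowerSeries.coeff α (qClean (p ^ e) (MvPowerSeries.subst θ G)) ≠ 0 ∧ (∀ l, c l = 0 → p ^ e ∣ α l) ∧ p ^ e ∣ Finsupp.weight w α) → (qClean (p ^ e) (succCoeff T') = 0 ∨ (qClean (p ^ e) (succCoeff T')).order < G.order))) := by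
  sorry

/-- `stub_datumOfLocalFuelCriterion` [XL, hardest, transfer C⁺ ⇒ crux, the lead's]: the LOCAL
FUEL CRITERION implies the existence of a weighted resolution datum in characteristic `p`.
Registered signature (verbatim). -/
theorem stub_datumOfLocalFuelCriterion : ∀ (p : ℕ), p.Prime → (∀ (k : Type) [Field k] [CharP k p] [PerfectField k] (e : ℕ), 0 < e → ∀ (m : ℕ) (G : MvPowerSeries (Fin m) k), G ≠ 0 → (∀ α : Fin m →₀ ℕ, (∀ l, p ^ e ∣ α l) → MvPowerSeries.coeff α G = 0) → ((p ^ e : ℕ) : ℕ∞) ≤ G.order → ∃ (θ : Fin m → MvPowerSeries (Fin m) k) (w : Fin m → ℕ), (∀ i, MvPowerSeries.constantCoeff (θ i) = 0) ∧ IsUnit (Matrix.det (Matrix.of fun i j => MvPowerSeries.coeff (Finsupp.single j 1) (θ i))) ∧ (qClean (p ^ e) (MvPowerSeries.subst θ G)).order = G.order ∧ (∃ i, 0 < w i) ∧ ∀ c : Fin m → k, (∀ i, w i = 0 → c i = 0) → c ≠ 0 → ∀ (d : ℕ) (T' : MvPowerSeries (Fin (m + 1)) k), MvPowerSeries.subst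 (CobordantChart.chart w c) (qClean (p ^ e) (MvPowerSeries.subst θ G)) = MvPowerSeries.X 0 ^ d * T' → ¬ (MvPowerSeries.X (0 : Fin (m + 1)) ∣ T') → 0 < d ∧ p ^ e ∣ d ∧ ((∀ j, MvPowerSeries.coeff (Finsupp.single j 1) T' = 0) → ∃ R : MvPowerSeries (Fin (m + 1)) k, MvPowerSeries.constantCoeff R = 0 ∧ succCoeff T' = qClean (p ^ e) (succCoeff T') + R ^ (p ^ e) ∧ (∀ α : Fin (m + 1) →₀ ℕ, (∀ l, p ^ e ∣ α l) → MvPowerSeries.coeff α (qClean (p ^ e) (succCoeff T')) = 0) ∧ (qClean (p ^ e) (succCoeff T') = 0 ∨ (qClean (p ^ e) (succCoeff T')).order < G.order))) → Nonempty (WeightedResolutionDatum p) := by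
  sorry

/-- Without fuel the successor coefficient series is clean (so cleaning does nothing to it). -/
theorem qClean_succCoeff_eq_of_noFuel {q : ℕ} {k : Type} [Field k] {m : ℕ}
    {T' : MvPowerSeries (Fin (m + 1)) k}
    (hT : ∀ β : Fin (m + 1) →₀ ℕ, (∀ l, q ∣ β l) → MvPowerSeries.coeff β T' = 0) :
    qClean q (succCoeff T') = succCoeff T' := by
  apply qClean_eq_self
  intro β hβ
  by_cases hβ0 : β = 0
  · subst hβ0
    rw [MvPowerSeries.coeff_zero_eq_constantCoeff_apply, constantCoeff_succCoeff]
  · rw [coeff_succCoeff_of_ne_zero T' hβ0, hT β hβ]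

/-- COMPOSITION: the five stubs give the crux `WeightedConstruction` BY NAME. -/
theorem WeightedConstruction_of : WeightedConstruction := by
  intro p hp
  refine stub_datumOfLocalFuelCriterion p hp ?_
  intro k _ _ _ e he m G hG hclean hord
  obtain ⟨θ, w, hθ0, hdet, hw, hmove⟩ := stub_fuelControlledMove p hp k e he m G hG hclean hord
  refine ⟨θ, w, hθ0, hdet, stub_cleanOrderStable p hp k e m G hclean θ hθ0 hdet, hw, ?_⟩
  intro c hc0 hc d T' hT hndvd
  obtain ⟨hd, hqd, hrest⟩ := hmove c hc0 hc d T' hT hndvd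
  refine ⟨hd, hqd, fun hlin => ?_⟩
  obtain ⟨hraw, hfuel⟩ := hrest hlin
  obtain ⟨R, hR, hR0⟩ := stub_cleanSplit p hp k e (m + 1) (succCoeff T')
  refine ⟨R, hR0 (constantCoeff_succCoeff T'), hR, isClean_qClean _ _, ?_⟩
  by_cases hF : ∃ α : Fin m →₀ ℕ, MvPowerSeries.coeff α (qClean (p ^ e) (MvPowerSeries.subst θ G)) ≠ 0 ∧
      (∀ l, c l = 0 → p ^ e ∣ α l) ∧ p ^ e ∣ Finsupp.weight w α
  · exact hfuel hF
  · rw [qClean_succCoeff_eq_of_noFuel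
      (stub_fuelLemma (p ^ e) k m (qClean (p ^ e) (MvPowerSeries.subst θ G)) w c hc0 d T' hqd hT hF)]
    exact hraw

end Summit.ResolutionOfSingularities.ResolutionOfSingularities.Cruxes.WeightedConstruction.WeightedObliqueFuel

end
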